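import Mathlib
import Summits.MatrixMultiplication.MatrixMultiplication.Theorems.SubgroupIdentityDesigns.Negative.FibreGhost

/-!
# Coset certificates: the general single-subgroup exclusion of level-one identity designs (all `p`)

Route `LevelGradedCohnUmans`, crux `SubgroupIdentityDesigns`, the `(m,k) = (2,1)` cell.  A level-`1`
function `F(g) = Σ_{rk M ≤ 1} c_M ψ(tr(M g))` is a constant plus a sum of functions of ONE VECTOR
`g ↦ φ(g a)` (`exists_vecMulVec_of_rank_le_one`, `trace_vecMulVec_mul`).  Hence, for a subgroup
`K ≤ GL₂(𝔽_p)` and a weight `f`, the weighted sum `Σ_{k ∈ K} f(k) F(k)` vanishes as soon as `f`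
sums to zero over every left coset `k · Stab_K(a)` of every vector stabiliser
(`sum_weight_mulVec_eq_zero`, `sum_weight_fourier_eq_zero`: average over the stabiliser and
re-index `k ↦ k s`).  If moreover `f(1) ≠ 0` and `K` sits inside a member of the triple, the
level-`1` identity design (`F(1) = 1`, `F = 0` on `H₁H₂H₃ ∖ 1`) is impossible:
`no_levelOne_design_of_coset_certificate` (+ `_mem₁/₂/₃`).  This is the GENERAL form of every
single-member certificate used so far (`O₂⁻`: `f = det`; `K_Δ`: a character of `det`; det-fixers:
`1_{K∩SL₂} − 1_{s₀(K∩SL₂)}`), and by linear duality it is also COMPLETE for single subgroups: a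
subgroup `K` carries such an `f` iff no level-`1` function is `1` at `1` and `0` on `K ∖ 1`.
Corollaries: the CHARACTER CERTIFICATE `no_levelOne_design_of_character_mem₁/₂/₃` (`f = χ`
multiplicative on `K` with `Σ_{s ∈ Stab_K(a)} χ(s) = 0` for every `a ≠ 0`, i.e. `χ` non-trivial on
every vector stabiliser) and its determinant form `no_levelOne_design_of_detChar_mem₁/₂/₃`
(`χ = θ ∘ det`).  New instances (census, `p = 13`): `Z·2T` (order `144`) and the preimage of `S₄`
(order `288`) in `GL₂(𝔽₁₃)`, which have no det-fixer and contain no `O₂⁻`, `K_Δ`.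
All `p`; single member; no TPP and no volume hypothesis.  VALUE = THEOREM, NOT summit progress; the
crux item stmt-MatrixMultiplication-14079 is untouched and remains open.
-/

set_option linter.dupNamespace false

noncomputable section

open scoped BigOperators Classical

open Summit.MatrixMultiplication.MatrixMultiplication.Theorems.LieRankDesigns.Negative (GLm Mat)

namespace Summit.MatrixMultiplication.MatrixMultiplication.Theorems.SubgroupIdentityDesigns.Negative

section CosetCertificate

variable {p : ℕ} [hp : Fact p.Prime]

/-- **Coset weights kill functions of one vector.**  If `f` sums to zero over every left coset
`k · Stab_K(a)` (`a ≠ 0` fixed), then `Σ_{k ∈ K} f(k) g(k a) = 0` for every `g`. -/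
theorem sum_weight_mulVec_eq_zero (K : Subgroup (GLm p 2)) (f : GLm p 2 → ℂ)
    (a : Fin 2 → ZMod p)
    (hf : ∀ k : K, (∑ s : K, if ((s : GLm p 2) : Mat p 2).mulVec a = a
      then f ((k : GLm p 2) * s) else 0) = 0)
    (g : (Fin 2 → ZMod p) → ℂ) :
    ∑ k : K, f k * g (((k : GLm p 2) : Mat p 2).mulVec a) = 0 := by
  set S := ∑ k : K, f k * g (((k : GLm p 2) : Mat p 2).mulVec a) with hS
  -- the double sum `T = Σ_k Σ_{s a = a} f(k s) g((k s) a)` computed two ways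
  set T := ∑ k : K, ∑ s : K, (if ((s : GLm p 2) : Mat p 2).mulVec a = a
      then f ((k : GLm p 2) * s) * g ((((k * s : K) : GLm p 2) : Mat p 2).mulVec a) else 0) with hT
  have hT0 : T = 0 := by
    refine Finset.sum_eq_zero fun k _ => ?_
    have hks : ∀ s : K, ((s : GLm p 2) : Mat p 2).mulVec a = a →
        (((k * s : K) : GLm p 2) : Mat p 2).mulVec a = ((k : GLm p 2) : Mat p 2).mulVec a := by
      intro s hs
      rw [Subgroup.coe_mul, Units.val_mul, ← Matrix.mulVec_mulVec, hs]
    calc (∑ s : K, if ((s : GLm p 2) : Mat p 2).mulVec a = a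
            then f ((k : GLm p 2) * s) * g ((((k * s : K) : GLm p 2) : Mat p 2).mulVec a) else 0)
        = ∑ s : K, (if ((s : GLm p 2) : Mat p 2).mulVec a = a
            then f ((k : GLm p 2) * s) else 0) * g (((k : GLm p 2) : Mat p 2).mulVec a) := by
          refine Finset.sum_congr rfl fun s _ => ?_
          split_ifs with hs
          · rw [hks s hs]
          · rw [zero_mul]
      _ = 0 := by rw [← Finset.sum_mul, hf k, zero_mul]
  have hTS : T = (∑ s : K, if ((s : GLm p 2) : Mat p 2).mulVec a = a then (1 : ℂ) else 0) * S := by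
    rw [hT, Finset.sum_comm, Finset.sum_mul]
    refine Finset.sum_congr rfl fun s _ => ?_
    split_ifs with hs
    · rw [one_mul, hS]
      exact Fintype.sum_equiv (Equiv.mulRight s)
        (fun k : K => f ((k : GLm p 2) * s) * g ((((k * s : K) : GLm p 2) : Mat p 2).mulVec a))
        (fun k : K => f k * g (((k : GLm p 2) : Mat p 2).mulVec a))
        (fun k => by simp only [Equiv.coe_mulRight, Subgroup.coe_mul])
    · simp
  have hN : (∑ s : K, if ((s : GLm p 2) : Mat p 2).mulVec a = a then (1 : ℂ) else 0) ≠ 0 := by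
    rw [Finset.sum_boole, Nat.cast_ne_zero, ← Nat.pos_iff_ne_zero, Finset.card_pos]
    refine ⟨1, ?_⟩
    simp only [Finset.mem_filter, Finset.mem_univ, true_and, Subgroup.coe_one, Units.val_one,
      Matrix.one_mulVec]
  have := hT0
  rw [hTS] at this
  exact (mul_eq_zero.mp this).resolve_left hN

/-- **Coset weights kill level-one functions.**  If `f` sums to zero over every left coset of
every vector stabiliser `Stab_K(a)`, `a ≠ 0`, then `Σ_{k ∈ K} f(k) F(k) = 0` for every level-`1`
function `F = Σ_{rk M ≤ 1} c_M ψ(tr(M ·))`. -/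
theorem sum_weight_fourier_eq_zero (K : Subgroup (GLm p 2)) (f : GLm p 2 → ℂ)
    (hf : ∀ a : Fin 2 → ZMod p, a ≠ 0 → ∀ k : K,
      (∑ s : K, if ((s : GLm p 2) : Mat p 2).mulVec a = a
        then f ((k : GLm p 2) * s) else 0) = 0)
    (c : Mat p 2 → ℂ) (hc : ∀ M : Mat p 2, 1 < M.rank → c M = 0) :
    ∑ k : K, f k * ∑ M : Mat p 2,
      c M * ZMod.stdAddChar (Matrix.trace (M * ((k : GLm p 2) : Mat p 2))) = 0 := by
  have hswap : ∑ k : K, f k * ∑ M : Mat p 2,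
      c M * ZMod.stdAddChar (Matrix.trace (M * ((k : GLm p 2) : Mat p 2))) =
      ∑ M : Mat p 2, c M * ∑ k : K,
        f k * ZMod.stdAddChar (Matrix.trace (M * ((k : GLm p 2) : Mat p 2))) := by
    simp_rw [Finset.mul_sum]
    rw [Finset.sum_comm]
    refine Finset.sum_congr rfl fun M _ => Finset.sum_congr rfl fun k _ => ?_
    ring
  rw [hswap]
  refine Finset.sum_eq_zero fun M _ => ?_
  by_cases hcM : c M = 0
  · rw [hcM, zero_mul]
  have hM : M.rank ≤ 1 := by
    by_contra h
    exact hcM (hc M (by omega))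
  have ha₀ : (![1, 0] : Fin 2 → ZMod p) ≠ 0 := fun h => by
    have := congr_fun h 0
    simp at this
  by_cases hM0 : M = 0
  · subst hM0
    have h := sum_weight_mulVec_eq_zero K f ![1, 0] (hf _ ha₀) (fun _ => 1)
    simp only [mul_one] at h
    simp [h]
  obtain ⟨a, b, ha, rfl⟩ := exists_vecMulVec_of_rank_le_one M hM hM0
  simp_rw [trace_vecMulVec_mul]
  rw [sum_weight_mulVec_eq_zero K f a (hf a ha) (fun w => ZMod.stdAddChar (b ⬝ᵥ w)), mul_zero]

/-- **COSET CERTIFICATE ⇒ NO LEVEL-ONE IDENTITY DESIGN.**  `K` a subgroup whose non-identity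
elements are triple products `a b g`, `f(1) ≠ 0`, and `f` sums to zero over every left coset of
every vector stabiliser in `K`.  All `p`; no TPP, no volume. -/
theorem no_levelOne_design_of_coset_certificate {H₁ H₂ H₃ : Subgroup (GLm p 2)}
    (K : Subgroup (GLm p 2)) (f : GLm p 2 → ℂ) (hf1 : f 1 ≠ 0)
    (hf : ∀ a : Fin 2 → ZMod p, a ≠ 0 → ∀ k : K,
      (∑ s : K, if ((s : GLm p 2) : Mat p 2).mulVec a = a
        then f ((k : GLm p 2) * s) else 0) = 0)
    (hmem : ∀ k ∈ K, k ≠ 1 → ∃ a ∈ H₁, ∃ b ∈ H₂, ∃ g ∈ H₃, a * b * g = k) :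
    ¬ ∃ c : Mat p 2 → ℂ, (∀ M, 1 < M.rank → c M = 0) ∧
      (∑ M, c M * ZMod.stdAddChar (Matrix.trace (M * ((1 : GLm p 2) : Mat p 2)))) = 1 ∧
      ∀ a ∈ H₁, ∀ b ∈ H₂, ∀ g ∈ H₃, a * b * g ≠ 1 →
        (∑ M, c M *
          ZMod.stdAddChar (Matrix.trace (M * ((a * b * g : GLm p 2) : Mat p 2)))) = 0 := by
  rintro ⟨c, hc, hc1, hc0⟩
  have h0 := sum_weight_fourier_eq_zero K f hf c hc
  rw [Fintype.sum_eq_single (1 : K)] at h0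
  · rw [Subgroup.coe_one, hc1, mul_one] at h0
    exact hf1 h0
  · intro k hk
    have hk' : (k : GLm p 2) ≠ 1 := fun h => hk (Subtype.ext h)
    obtain ⟨a, ha, b, hb, g, hg, e⟩ := hmem k k.2 hk'
    rw [← e, hc0 a ha b hb g hg (by rw [e]; exact hk'), mul_zero]

/-- Coset certificate inside the MIDDLE member. -/
theorem no_levelOne_design_of_coset_certificate_mem₂ {H₁ H₂ H₃ : Subgroup (GLm p 2)}
    (K : Subgroup (GLm p 2)) (hKH : K ≤ H₂) (f : GLm p 2 → ℂ) (hf1 : f 1 ≠ 0)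
    (hf : ∀ a : Fin 2 → ZMod p, a ≠ 0 → ∀ k : K,
      (∑ s : K, if ((s : GLm p 2) : Mat p 2).mulVec a = a
        then f ((k : GLm p 2) * s) else 0) = 0) :
    ¬ ∃ c : Mat p 2 → ℂ, (∀ M, 1 < M.rank → c M = 0) ∧
      (∑ M, c M * ZMod.stdAddChar (Matrix.trace (M * ((1 : GLm p 2) : Mat p 2)))) = 1 ∧
      ∀ a ∈ H₁, ∀ b ∈ H₂, ∀ g ∈ H₃, a * b * g ≠ 1 →
        (∑ M, c M *
          ZMod.stdAddChar (Matrix.trace (M * ((a * b * g : GLm p 2) : Mat p 2)))) = 0 :=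
  no_levelOne_design_of_coset_certificate K f hf1 hf
    (fun k hk _ => ⟨1, H₁.one_mem, k, hKH hk, 1, H₃.one_mem, by rw [one_mul, mul_one]⟩)

/-- Coset certificate inside the FIRST member. -/
theorem no_levelOne_design_of_coset_certificate_mem₁ {H₁ H₂ H₃ : Subgroup (GLm p 2)}
    (K : Subgroup (GLm p 2)) (hKH : K ≤ H₁) (f : GLm p 2 → ℂ) (hf1 : f 1 ≠ 0)
    (hf : ∀ a : Fin 2 → ZMod p, a ≠ 0 → ∀ k : K,
      (∑ s : K, if ((s : GLm p 2) : Mat p 2).mulVec a = a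
        then f ((k : GLm p 2) * s) else 0) = 0) :
    ¬ ∃ c : Mat p 2 → ℂ, (∀ M, 1 < M.rank → c M = 0) ∧
      (∑ M, c M * ZMod.stdAddChar (Matrix.trace (M * ((1 : GLm p 2) : Mat p 2)))) = 1 ∧
      ∀ a ∈ H₁, ∀ b ∈ H₂, ∀ g ∈ H₃, a * b * g ≠ 1 →
        (∑ M, c M *
          ZMod.stdAddChar (Matrix.trace (M * ((a * b * g : GLm p 2) : Mat p 2)))) = 0 :=
  no_levelOne_design_of_coset_certificate K f hf1 hf
    (fun k hk _ => ⟨k, hKH hk, 1, H₂.one_mem, 1, H₃.one_mem, by rw [mul_one, mul_one]⟩)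

/-- Coset certificate inside the LAST member. -/
theorem no_levelOne_design_of_coset_certificate_mem₃ {H₁ H₂ H₃ : Subgroup (GLm p 2)}
    (K : Subgroup (GLm p 2)) (hKH : K ≤ H₃) (f : GLm p 2 → ℂ) (hf1 : f 1 ≠ 0)
    (hf : ∀ a : Fin 2 → ZMod p, a ≠ 0 → ∀ k : K,
      (∑ s : K, if ((s : GLm p 2) : Mat p 2).mulVec a = a
        then f ((k : GLm p 2) * s) else 0) = 0) :
    ¬ ∃ c : Mat p 2 → ℂ, (∀ M, 1 < M.rank → c M = 0) ∧
      (∑ M, c M * ZMod.stdAddChar (Matrix.trace (M * ((1 : GLm p 2) : Mat p 2)))) = 1 ∧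
      ∀ a ∈ H₁, ∀ b ∈ H₂, ∀ g ∈ H₃, a * b * g ≠ 1 →
        (∑ M, c M *
          ZMod.stdAddChar (Matrix.trace (M * ((a * b * g : GLm p 2) : Mat p 2)))) = 0 :=
  no_levelOne_design_of_coset_certificate K f hf1 hf
    (fun k hk _ => ⟨1, H₁.one_mem, 1, H₂.one_mem, k, hKH hk, by rw [one_mul, one_mul]⟩)

/-- A multiplicative weight `χ` that sums to zero over every vector stabiliser is a coset
certificate. -/
theorem coset_weight_of_character (K : Subgroup (GLm p 2)) (χ : GLm p 2 → ℂ)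
    (hmul : ∀ k ∈ K, ∀ s ∈ K, χ (k * s) = χ k * χ s)
    (hstab : ∀ a : Fin 2 → ZMod p, a ≠ 0 →
      (∑ s : K, if ((s : GLm p 2) : Mat p 2).mulVec a = a then χ s else 0) = 0) :
    ∀ a : Fin 2 → ZMod p, a ≠ 0 → ∀ k : K,
      (∑ s : K, if ((s : GLm p 2) : Mat p 2).mulVec a = a
        then χ ((k : GLm p 2) * s) else 0) = 0 := by
  intro a ha k
  calc (∑ s : K, if ((s : GLm p 2) : Mat p 2).mulVec a = a then χ ((k : GLm p 2) * s) else 0)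
      = ∑ s : K, χ k * (if ((s : GLm p 2) : Mat p 2).mulVec a = a then χ s else 0) := by
        refine Finset.sum_congr rfl fun s _ => ?_
        split_ifs
        · exact hmul k k.2 s s.2
        · rw [mul_zero]
    _ = 0 := by rw [← Finset.mul_sum, hstab a ha, mul_zero]

/-- **CHARACTER CERTIFICATE, member `H₁`.**  `K ≤ H₁`, `χ` multiplicative on `K` with `χ 1 ≠ 0`
and `Σ_{s ∈ K, s a = a} χ(s) = 0` for every `a ≠ 0` (i.e. `χ` is non-trivial on every vector
stabiliser) ⇒ no level-one identity design.  All `p`; no TPP. -/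
theorem no_levelOne_design_of_character_mem₁ {H₁ H₂ H₃ : Subgroup (GLm p 2)}
    (K : Subgroup (GLm p 2)) (hKH : K ≤ H₁) (χ : GLm p 2 → ℂ) (hχ1 : χ 1 ≠ 0)
    (hmul : ∀ k ∈ K, ∀ s ∈ K, χ (k * s) = χ k * χ s)
    (hstab : ∀ a : Fin 2 → ZMod p, a ≠ 0 →
      (∑ s : K, if ((s : GLm p 2) : Mat p 2).mulVec a = a then χ s else 0) = 0) :
    ¬ ∃ c : Mat p 2 → ℂ, (∀ M, 1 < M.rank → c M = 0) ∧
      (∑ M, c M * ZMod.stdAddChar (Matrix.trace (M * ((1 : GLm p 2) : Mat p 2)))) = 1 ∧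
      ∀ a ∈ H₁, ∀ b ∈ H₂, ∀ g ∈ H₃, a * b * g ≠ 1 →
        (∑ M, c M *
          ZMod.stdAddChar (Matrix.trace (M * ((a * b * g : GLm p 2) : Mat p 2)))) = 0 :=
  no_levelOne_design_of_coset_certificate_mem₁ K hKH χ hχ1 (coset_weight_of_character K χ hmul hstab)

/-- **CHARACTER CERTIFICATE, member `H₂`.** -/
theorem no_levelOne_design_of_character_mem₂ {H₁ H₂ H₃ : Subgroup (GLm p 2)}
    (K : Subgroup (GLm p 2)) (hKH : K ≤ H₂) (χ : GLm p 2 → ℂ) (hχ1 : χ 1 ≠ 0)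
    (hmul : ∀ k ∈ K, ∀ s ∈ K, χ (k * s) = χ k * χ s)
    (hstab : ∀ a : Fin 2 → ZMod p, a ≠ 0 →
      (∑ s : K, if ((s : GLm p 2) : Mat p 2).mulVec a = a then χ s else 0) = 0) :
    ¬ ∃ c : Mat p 2 → ℂ, (∀ M, 1 < M.rank → c M = 0) ∧
      (∑ M, c M * ZMod.stdAddChar (Matrix.trace (M * ((1 : GLm p 2) : Mat p 2)))) = 1 ∧
      ∀ a ∈ H₁, ∀ b ∈ H₂, ∀ g ∈ H₃, a * b * g ≠ 1 →
        (∑ M, c M *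
          ZMod.stdAddChar (Matrix.trace (M * ((a * b * g : GLm p 2) : Mat p 2)))) = 0 :=
  no_levelOne_design_of_coset_certificate_mem₂ K hKH χ hχ1 (coset_weight_of_character K χ hmul hstab)

/-- **CHARACTER CERTIFICATE, member `H₃`.** -/
theorem no_levelOne_design_of_character_mem₃ {H₁ H₂ H₃ : Subgroup (GLm p 2)}
    (K : Subgroup (GLm p 2)) (hKH : K ≤ H₃) (χ : GLm p 2 → ℂ) (hχ1 : χ 1 ≠ 0)
    (hmul : ∀ k ∈ K, ∀ s ∈ K, χ (k * s) = χ k * χ s)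
    (hstab : ∀ a : Fin 2 → ZMod p, a ≠ 0 →
      (∑ s : K, if ((s : GLm p 2) : Mat p 2).mulVec a = a then χ s else 0) = 0) :
    ¬ ∃ c : Mat p 2 → ℂ, (∀ M, 1 < M.rank → c M = 0) ∧
      (∑ M, c M * ZMod.stdAddChar (Matrix.trace (M * ((1 : GLm p 2) : Mat p 2)))) = 1 ∧
      ∀ a ∈ H₁, ∀ b ∈ H₂, ∀ g ∈ H₃, a * b * g ≠ 1 →
        (∑ M, c M *
          ZMod.stdAddChar (Matrix.trace (M * ((a * b * g : GLm p 2) : Mat p 2)))) = 0 :=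
  no_levelOne_design_of_coset_certificate_mem₃ K hKH χ hχ1 (coset_weight_of_character K χ hmul hstab)

/-- **DETERMINANT-CHARACTER CERTIFICATE** (members `H₁`, `H₂`, `H₃`): `θ` multiplicative on
`𝔽_p` with `θ 1 ≠ 0` and `Σ_{s ∈ K, s a = a} θ(det s) = 0` for every `a ≠ 0` ⇒ no level-one
identity design.  (`θ(−1) = −1` on a group generated by reflections recovers `O₂⁻`; a character of
`Δ` recovers `K_Δ`.) -/
theorem no_levelOne_design_of_detChar_mem₁ {H₁ H₂ H₃ : Subgroup (GLm p 2)}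
    (K : Subgroup (GLm p 2)) (hKH : K ≤ H₁) (θ : ZMod p → ℂ) (hθ1 : θ 1 ≠ 0)
    (hθ : ∀ x y : ZMod p, θ (x * y) = θ x * θ y)
    (hstab : ∀ a : Fin 2 → ZMod p, a ≠ 0 →
      (∑ s : K, if ((s : GLm p 2) : Mat p 2).mulVec a = a
        then θ (Matrix.det ((s : GLm p 2) : Mat p 2)) else 0) = 0) :
    ¬ ∃ c : Mat p 2 → ℂ, (∀ M, 1 < M.rank → c M = 0) ∧
      (∑ M, c M * ZMod.stdAddChar (Matrix.trace (M * ((1 : GLm p 2) : Mat p 2)))) = 1 ∧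
      ∀ a ∈ H₁, ∀ b ∈ H₂, ∀ g ∈ H₃, a * b * g ≠ 1 →
        (∑ M, c M *
          ZMod.stdAddChar (Matrix.trace (M * ((a * b * g : GLm p 2) : Mat p 2)))) = 0 :=
  no_levelOne_design_of_character_mem₁ K hKH (fun k => θ (Matrix.det (k : Mat p 2)))
    (by rwa [Units.val_one, Matrix.det_one])
    (fun k _ s _ => by rw [Units.val_mul, Matrix.det_mul, hθ]) hstab

/-- Determinant-character certificate inside the MIDDLE member. -/
theorem no_levelOne_design_of_detChar_mem₂ {H₁ H₂ H₃ : Subgroup (GLm p 2)}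
    (K : Subgroup (GLm p 2)) (hKH : K ≤ H₂) (θ : ZMod p → ℂ) (hθ1 : θ 1 ≠ 0)
    (hθ : ∀ x y : ZMod p, θ (x * y) = θ x * θ y)
    (hstab : ∀ a : Fin 2 → ZMod p, a ≠ 0 →
      (∑ s : K, if ((s : GLm p 2) : Mat p 2).mulVec a = a
        then θ (Matrix.det ((s : GLm p 2) : Mat p 2)) else 0) = 0) :
    ¬ ∃ c : Mat p 2 → ℂ, (∀ M, 1 < M.rank → c M = 0) ∧
      (∑ M, c M * ZMod.stdAddChar (Matrix.trace (M * ((1 : GLm p 2) : Mat p 2)))) = 1 ∧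
      ∀ a ∈ H₁, ∀ b ∈ H₂, ∀ g ∈ H₃, a * b * g ≠ 1 →
        (∑ M, c M *
          ZMod.stdAddChar (Matrix.trace (M * ((a * b * g : GLm p 2) : Mat p 2)))) = 0 :=
  no_levelOne_design_of_character_mem₂ K hKH (fun k => θ (Matrix.det (k : Mat p 2)))
    (by rwa [Units.val_one, Matrix.det_one])
    (fun k _ s _ => by rw [Units.val_mul, Matrix.det_mul, hθ]) hstab

/-- Determinant-character certificate inside the LAST member. -/
theorem no_levelOne_design_of_detChar_mem₃ {H₁ H₂ H₃ : Subgroup (GLm p 2)}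
    (K : Subgroup (GLm p 2)) (hKH : K ≤ H₃) (θ : ZMod p → ℂ) (hθ1 : θ 1 ≠ 0)
    (hθ : ∀ x y : ZMod p, θ (x * y) = θ x * θ y)
    (hstab : ∀ a : Fin 2 → ZMod p, a ≠ 0 →
      (∑ s : K, if ((s : GLm p 2) : Mat p 2).mulVec a = a
        then θ (Matrix.det ((s : GLm p 2) : Mat p 2)) else 0) = 0) :
    ¬ ∃ c : Mat p 2 → ℂ, (∀ M, 1 < M.rank → c M = 0) ∧
      (∑ M, c M * ZMod.stdAddChar (Matrix.trace (M * ((1 : GLm p 2) : Mat p 2)))) = 1 ∧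
      ∀ a ∈ H₁, ∀ b ∈ H₂, ∀ g ∈ H₃, a * b * g ≠ 1 →
        (∑ M, c M *
          ZMod.stdAddChar (Matrix.trace (M * ((a * b * g : GLm p 2) : Mat p 2)))) = 0 :=
  no_levelOne_design_of_character_mem₃ K hKH (fun k => θ (Matrix.det (k : Mat p 2)))
    (by rwa [Units.val_one, Matrix.det_one])
    (fun k _ s _ => by rw [Units.val_mul, Matrix.det_mul, hθ]) hstab

end CosetCertificate

end Summit.MatrixMultiplication.MatrixMultiplication.Theorems.SubgroupIdentityDesigns.Negative
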